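import Mathlib
import Summits.Ventures.HodgeRepro2.T5DeltaTwistBilinForm

/-!
# T5QuadraticTrace — `tr_{E/F} z = z + z̄` and `N_{E/F} z = z z̄` for a quadratic Galois extension
(Tier-5 §N2.9.2 support)

`T5DeltaTwistBilinForm` (p399055) kept the identity «`Algebra.trace F E z = z + star z`» as a
HYPOTHESIS `htr` (§37(a) of route/T5-SUPPORT-p3.md: «the case of a separable quadratic `E_v/F_v`
with `star` the non-trivial automorphism — kept as a hypothesis»).  This file DISCHARGES it:

* for `E/F` Galois of degree `2` the automorphism group is `{1, σ}` for any `σ ≠ 1`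
  (`univ_eq_pair`), so Mathlib's `trace_eq_sum_automorphisms` / `Algebra.norm_eq_prod_automorphisms`
  read `tr z = z + σ z` (`algebraMap_trace_eq_add_apply`) and `N z = z · σ z`
  (`algebraMap_norm_eq_mul_apply`);
* a `StarRing` structure on `E` fixing `F` pointwise and not the identity IS such a `σ`
  (`starAlgEquiv`), hence `tr z = z + star z` (`algebraMap_trace_eq_add_star` — exactly `htr`) and
  `N z = z · star z` (`algebraMap_norm_eq_mul_star`: the hermitian norm form);
* consequently THE SYMPLECTIC STATEMENT of `T5DeltaTwistBilinForm` holds for every quadratic Galois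
  `E/F` with `star` the non-trivial automorphism, with no trace hypothesis
  (`isAlt_and_nondegenerate_traceBilin_of_quadratic`), on a space of `F`-dimension `|ι|·|κ|·2`
  (`finrank_tensorSpace_of_quadratic`).

Prose (unchanged): that `E_v/F_v` is the completion of the CM extension at `v` with `star` its
conjugation, and Kudla's splitting.
-/

namespace Summit.Ventures.HodgeRepro2.T5QuadraticTrace

open Summit.Ventures.HodgeRepro2

variable {F E : Type*} [Field F] [Field E] [Algebra F E]

section Galois

variable [FiniteDimensional F E] [IsGalois F E]

/-- In a Galois extension of degree `2`, the automorphism group is `{1, σ}` for any `σ ≠ 1`. -/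
theorem univ_eq_pair [DecidableEq (E ≃ₐ[F] E)] (h2 : Module.finrank F E = 2) (σ : E ≃ₐ[F] E)
    (hσ : σ ≠ 1) : (Finset.univ : Finset (E ≃ₐ[F] E)) = {1, σ} := by
  symm
  apply Finset.eq_univ_of_card
  rw [Finset.card_pair (Ne.symm hσ), ← Nat.card_eq_fintype_card, IsGalois.card_aut_eq_finrank, h2]

/-- Every automorphism of a quadratic Galois extension is an involution: `σ * σ = 1`. -/
theorem mul_self_eq_one (h2 : Module.finrank F E = 2) (σ : E ≃ₐ[F] E) : σ * σ = 1 := by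
  have h := pow_card_eq_one' (x := σ)
  rwa [IsGalois.card_aut_eq_finrank, h2, pow_two] at h

/-- `σ (σ z) = z` for every automorphism of a quadratic Galois extension. -/
theorem apply_apply (h2 : Module.finrank F E = 2) (σ : E ≃ₐ[F] E) (z : E) : σ (σ z) = z := by
  have h := congrArg (fun τ : E ≃ₐ[F] E => τ z) (mul_self_eq_one h2 σ)
  simpa using h

/-- **The trace of a quadratic Galois extension**: `tr_{E/F} z = z + σ z` for the non-trivial
automorphism `σ` (Mathlib's `trace_eq_sum_automorphisms` over the two-element group). -/
theorem algebraMap_trace_eq_add_apply (h2 : Module.finrank F E = 2) (σ : E ≃ₐ[F] E) (hσ : σ ≠ 1)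
    (z : E) : algebraMap F E (Algebra.trace F E z) = z + σ z := by
  classical
  rw [trace_eq_sum_automorphisms, univ_eq_pair h2 σ hσ, Finset.sum_pair (Ne.symm hσ)]
  simp

/-- **The norm of a quadratic Galois extension**: `N_{E/F} z = z · σ z` for the non-trivial
automorphism `σ` (Mathlib's `Algebra.norm_eq_prod_automorphisms` over the two-element group). -/
theorem algebraMap_norm_eq_mul_apply (h2 : Module.finrank F E = 2) (σ : E ≃ₐ[F] E) (hσ : σ ≠ 1)
    (z : E) : algebraMap F E (Algebra.norm F z) = z * σ z := by
  classical
  rw [Algebra.norm_eq_prod_automorphisms, univ_eq_pair h2 σ hσ, Finset.prod_pair (Ne.symm hσ)]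
  simp

end Galois

section Star

variable [StarRing E]

/-- A `star` structure on `E` fixing `F` pointwise, as an `F`-algebra automorphism of `E`. -/
noncomputable def starAlgEquiv (hF : ∀ c : F, star (algebraMap F E c) = algebraMap F E c) :
    E ≃ₐ[F] E :=
  AlgEquiv.ofRingEquiv (f := starRingAut) hF

/-- `starAlgEquiv hF` acts as `star`. -/
@[simp]
theorem starAlgEquiv_apply (hF : ∀ c : F, star (algebraMap F E c) = algebraMap F E c) (z : E) :
    starAlgEquiv hF z = star z := rfl

/-- If `star` is not the identity, `starAlgEquiv` is a non-trivial automorphism. -/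
theorem starAlgEquiv_ne_one (hF : ∀ c : F, star (algebraMap F E c) = algebraMap F E c)
    (hne : ∃ z : E, star z ≠ z) : starAlgEquiv hF ≠ 1 := by
  obtain ⟨z, hz⟩ := hne
  intro h
  apply hz
  have := congrArg (fun τ : E ≃ₐ[F] E => τ z) h
  simpa using this

variable [FiniteDimensional F E] [IsGalois F E]

/-- **`htr` of `T5DeltaTwistBilinForm` discharged**: for `E/F` Galois of degree `2` and `star` a
non-trivial conjugation fixing `F`, `tr_{E/F} z = z + star z`. -/
theorem algebraMap_trace_eq_add_star (h2 : Module.finrank F E = 2)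
    (hF : ∀ c : F, star (algebraMap F E c) = algebraMap F E c) (hne : ∃ z : E, star z ≠ z) (z : E) :
    algebraMap F E (Algebra.trace F E z) = z + star z :=
  algebraMap_trace_eq_add_apply h2 (starAlgEquiv hF) (starAlgEquiv_ne_one hF hne) z

/-- The hermitian norm form: `N_{E/F} z = z · star z` under the same hypotheses. -/
theorem algebraMap_norm_eq_mul_star (h2 : Module.finrank F E = 2)
    (hF : ∀ c : F, star (algebraMap F E c) = algebraMap F E c) (hne : ∃ z : E, star z ≠ z) (z : E) :
    algebraMap F E (Algebra.norm F z) = z * star z :=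
  algebraMap_norm_eq_mul_apply h2 (starAlgEquiv hF) (starAlgEquiv_ne_one hF hne) z

/-- The trace of a `star`-fixed element is twice the element. -/
theorem algebraMap_trace_eq_two_mul_of_star_eq (h2 : Module.finrank F E = 2)
    (hF : ∀ c : F, star (algebraMap F E c) = algebraMap F E c) (hne : ∃ z : E, star z ≠ z) {z : E}
    (hz : star z = z) : algebraMap F E (Algebra.trace F E z) = 2 * z := by
  rw [algebraMap_trace_eq_add_star h2 hF hne, hz, two_mul]

/-- The trace of a `star`-anti-invariant element (`star z = -z`) vanishes. -/
theorem trace_eq_zero_of_star_eq_neg (h2 : Module.finrank F E = 2)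
    (hF : ∀ c : F, star (algebraMap F E c) = algebraMap F E c) (hne : ∃ z : E, star z ≠ z) {z : E}
    (hz : star z = -z) : Algebra.trace F E z = 0 := by
  apply (algebraMap F E).injective
  rw [algebraMap_trace_eq_add_star h2 hF hne, hz, add_neg_cancel, map_zero]

open Matrix Kronecker in
/-- **THE SYMPLECTIC STATEMENT of `T5DeltaTwistBilinForm` for a quadratic Galois `E/F`** with `star`
its non-trivial automorphism: the `F`-bilinear form `tr_{E/F}(h ⊗ s)` on `Res_{E/F}(V ⊗_E W)` is
alternating and non-degenerate for `M` hermitian, `N` skew-hermitian, `M ⊗ₖ N` invertible, `2 ≠ 0` —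
with no trace hypothesis. -/
theorem isAlt_and_nondegenerate_traceBilin_of_quadratic {ι κ : Type*} [Fintype ι] [Fintype κ]
    [DecidableEq ι] [DecidableEq κ] (h2 : Module.finrank F E = 2)
    (hF : ∀ c : F, star (algebraMap F E c) = algebraMap F E c) (hne : ∃ z : E, star z ≠ z)
    {M : Matrix ι ι E} {N : Matrix κ κ E} (hM : Mᴴ = M) (hN : Nᴴ = -N) (hMd : IsUnit M.det)
    (hNd : IsUnit N.det) (h2ne : (2 : E) ≠ 0) :
    (T5DeltaTwistBilinForm.traceBilin hF (M ⊗ₖ N)).IsAlt ∧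
      (T5DeltaTwistBilinForm.traceBilin hF (M ⊗ₖ N)).Nondegenerate :=
  T5DeltaTwistBilinForm.isAlt_and_nondegenerate_traceBilin hF
    (algebraMap_trace_eq_add_star h2 hF hne) hM hN hMd hNd h2ne

end Star

/-- The `F`-dimension of `Res_{E/F}(V ⊗_E W)` is `|ι|·|κ|·2` for a quadratic `E/F`. -/
theorem finrank_tensorSpace_of_quadratic [FiniteDimensional F E] {ι κ : Type*} [Fintype ι]
    [Fintype κ] (h2 : Module.finrank F E = 2) :
    Module.finrank F (ι × κ → E) = Fintype.card ι * Fintype.card κ * 2 := by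
  rw [T5DeltaTwistBilinForm.finrank_tensorSpace, h2]

end Summit.Ventures.HodgeRepro2.T5QuadraticTrace
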